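import Summits.CriticalPhenomena.PercolationContinuityZ3.Theorems.PercNearOneGluingNoHeavyLowerTailSpectatorExchangeRobust
import Literature.Probability.Percolation.KozmaNitzanPreFKG
import HarnessLib

/-!
# `NoHeavyLowerTail` (stmt-CriticalPhenomena-4575) — the spectator exchange BEYOND the weakest-spectator ranking:
# the conclusion of T(i) whenever at most one of `z, p, p′` is strictly less `b`-reliable than the spectator

Support file (lemma factory `prim-lf-3` gen 15; `--supports stmt-CriticalPhenomena-4575`).  No definitions, no named facts,
no sorries.  Memo: `run/shared/lean/prim/prim-lf-3/LF3-BETA-R.md` §18.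

Setting of `spectatorExchange_robust` (gen 13): a finite weighted graph `w`, target `b`, a pair `A = {p, p′}`, a spectator `j`,
a further vertex `z`, `a_v = P(v↔b)`,
`D := P((p↔b ∪ p′↔b), z↮b, z↮p, z↮p′, z↮j) − P(z↔b, p↮b, p′↮b, (j↔p ∪ j↔p′))`.
Gen 13 proved `a_j − a_z ≤ D` when the spectator is the least reliable of `p, p′, j` (`spectatorExchange_weakest`, the
regime-I atom T(i) of the formal face).  In the face programme the inequality is needed in the glued graph `K_u/Y` while the
ranking is known in `K_u`; after gluing, the ranking may FLIP.  THIS FILE shows that most flips are harmless, with two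
one-line consequences of Kozma–Nitzan's Lemma 3:

* `spectatorExchange_portBelow` — if `a_p ≤ a_z` then `a_p − a_z ≤ D` (Lemma 3(i) for the pair `(p, z)` with the increasing
  event `{z↔p′} ∪ {z↔j}` of `C_z`; no hypothesis on `j`);  `spectatorExchange_portBelow'` — the same for `p′`.
* `spectatorExchange_blockBelow` — if `a_z ≤ a_p` then `0 ≤ D` (Lemma 3(ii) for `(z, p)` with the decreasing event
  `{z ↮ j, p, p′}` of `C_z`);  `spectatorExchange_blockBelow'` — the same for `p′`.
* `spectatorExchange_atMostOneBelow` — **T(i) beyond the weakest-spectator regime**: if at most one of `z, p, p′` is strictly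
  less `b`-reliable than `j` (hypotheses `a_j ≤ a_z ∨ a_j ≤ a_p`, `a_j ≤ a_z ∨ a_j ≤ a_{p′}`, `a_j ≤ a_p ∨ a_j ≤ a_{p′}`), then
  `a_j − a_z ≤ D`.
Consequently the per-atom ranking hypothesis of `face_regimeI` (gen 13) is only needed at the atoms `Y` where at least two of
`[Y], p₁, p₂` overtake the witness in `K_u/Y` (the "hard core" of the anchoring problem, memo §18).
[cite: KozmaNitzan2024, Lemma 3 (pp. 6–7), Lemma 4 and (9) (pp. 9–10), Question 7 and Question 9 (p. 36)]
-/

namespace Summit.CriticalPhenomena.PercolationContinuityZ3.Theorems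

open MeasureTheory Set Literature.Probability.LatticeModels Literature.Probability.Percolation
open Literature.Probability.Percolation.KNPreFKG
open scoped Classical

noncomputable section

namespace UpsetExchange

universe u

variable {V : Type u} [Fintype V]

/-- **A port below the block**: with `D` as in the module docstring, if `a_p ≤ a_z` then `a_p − a_z ≤ D` (no hypothesis on the
spectator).  Kozma–Nitzan Lemma 3(i) for `(p, z)` with the increasing event `{z↔p′} ∪ {z↔j}` of the cluster of `z`, plus two
inclusions off that event. [cite: KozmaNitzan2024, Lemma 3(i) (pp. 6–7), (9) (pp. 9–10)] -/
theorem spectatorExchange_portBelow (w : Sym2 V → unitInterval) (b z j p p' : V)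
    (hpz : (prodBernoulli w).real (openConn p b) ≤ (prodBernoulli w).real (openConn z b)) :
    (prodBernoulli w).real (openConn p b) - (prodBernoulli w).real (openConn z b) ≤
      (prodBernoulli w).real ((openConn p b ∪ openConn p' b) ∩ (openConn z b)ᶜ ∩ (openConn z p)ᶜ ∩
          (openConn z p')ᶜ ∩ (openConn z j)ᶜ) -
        (prodBernoulli w).real (openConn z b ∩ (openConn p b)ᶜ ∩ (openConn p' b)ᶜ ∩ (openConn j p ∪ openConn j p')) := by
  set μ := prodBernoulli w with hμ
  have hmeas : ∀ X : Set (BondConfig V), MeasurableSet X := fun _ => MeasurableSet.of_discrete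
  -- the increasing event `Q = {z↔p'} ∪ {z↔j}` of `C_z`
  set Q : Set (BondConfig V) := openConn z p' ∪ openConn z j with hQdef
  set 𝒬 : Set (Set (Sym2 V)) := connFamily z p' ∪ connFamily z j with h𝒬
  have h𝒬up : IsUpperSet 𝒬 := (isUpperSet_connFamily z p').union (isUpperSet_connFamily z j)
  have hQ : {ω : BondConfig V | openEdgeCluster ω z ∈ 𝒬} = Q := by
    ext ω
    simp only [h𝒬, hQdef, mem_setOf_eq, mem_union]
    rw [openConn_eq_setOf_connFamily z p', openConn_eq_setOf_connFamily z j]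
    rfl
  -- Lemma 3(i): `μ(pb ∩ Q) ≤ μ(zb ∩ Q)`
  have L3 := KozmaNitzan2024_lemma3_i w p z b (le_refl (0 : ℝ)) (by linarith) h𝒬up
  rw [hQ, zero_mul, add_zero] at L3
  -- split both reliabilities along `Q`
  have hsp := measureReal_inter_add_sdiff (μ := μ) (s := openConn p b) (hmeas Q) (measure_ne_top _ _)
  have hsz := measureReal_inter_add_sdiff (μ := μ) (s := openConn z b) (hmeas Q) (measure_ne_top _ _)
  -- off `Q`, split along the other reliability; the doubly-connected parts coincide
  have hsp2 := measureReal_inter_add_sdiff (μ := μ) (s := openConn p b \ Q) (hmeas (openConn z b)) (measure_ne_top _ _)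
  have hsz2 := measureReal_inter_add_sdiff (μ := μ) (s := openConn z b \ Q) (hmeas (openConn p b)) (measure_ne_top _ _)
  have hsame : ((openConn p b \ Q) ∩ openConn z b : Set (BondConfig V)) = (openConn z b \ Q) ∩ openConn p b := by
    ext ω
    simp only [mem_inter_iff, mem_sdiff]
    tauto
  -- `{pb, ¬Q, ¬zb} ⊆ D⁺`
  have h1 : μ.real ((openConn p b \ Q) \ openConn z b) ≤
      μ.real ((openConn p b ∪ openConn p' b) ∩ (openConn z b)ᶜ ∩ (openConn z p)ᶜ ∩ (openConn z p')ᶜ ∩ (openConn z j)ᶜ) := by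
    apply measureReal_mono
    · rintro ω ⟨⟨hpbω, hQω⟩, hzbω⟩
      simp only [hQdef, mem_union, not_or] at hQω
      obtain ⟨hzp', hzj⟩ := hQω
      refine ⟨⟨⟨⟨Or.inl hpbω, hzbω⟩, fun hzp => hzbω ?_⟩, hzp'⟩, hzj⟩
      exact (hzp : (openGraph ω).Reachable z p).trans (hpbω : (openGraph ω).Reachable p b)
    · exact measure_ne_top _ _
  -- `D⁻ ⊆ {zb, ¬Q, ¬pb}`
  have h2 : μ.real (openConn z b ∩ (openConn p b)ᶜ ∩ (openConn p' b)ᶜ ∩ (openConn j p ∪ openConn j p')) ≤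
      μ.real ((openConn z b \ Q) \ openConn p b) := by
    apply measureReal_mono
    · rintro ω ⟨⟨⟨hzbω, hpbω⟩, hp'bω⟩, hjA⟩
      refine ⟨⟨hzbω, ?_⟩, hpbω⟩
      simp only [hQdef, mem_union, not_or]
      refine ⟨fun hzp' => hp'bω ?_, fun hzj => ?_⟩
      · exact (hzp' : (openGraph ω).Reachable z p').symm.trans (hzbω : (openGraph ω).Reachable z b)
      · rcases hjA with hjp | hjp'
        · exact hpbω (((hjp : (openGraph ω).Reachable j p).symm.trans
            (hzj : (openGraph ω).Reachable z j).symm).trans (hzbω : (openGraph ω).Reachable z b))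
        · exact hp'bω (((hjp' : (openGraph ω).Reachable j p').symm.trans
            (hzj : (openGraph ω).Reachable z j).symm).trans (hzbω : (openGraph ω).Reachable z b))
    · exact measure_ne_top _ _
  rw [hsame] at hsp2
  linarith

/-- **A port below the block**, second port: if `a_{p′} ≤ a_z` then `a_{p′} − a_z ≤ D`.
[cite: KozmaNitzan2024, Lemma 3(i) (pp. 6–7), (9) (pp. 9–10)] -/
theorem spectatorExchange_portBelow' (w : Sym2 V → unitInterval) (b z j p p' : V)
    (hp'z : (prodBernoulli w).real (openConn p' b) ≤ (prodBernoulli w).real (openConn z b)) :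
    (prodBernoulli w).real (openConn p' b) - (prodBernoulli w).real (openConn z b) ≤
      (prodBernoulli w).real ((openConn p b ∪ openConn p' b) ∩ (openConn z b)ᶜ ∩ (openConn z p)ᶜ ∩
          (openConn z p')ᶜ ∩ (openConn z j)ᶜ) -
        (prodBernoulli w).real (openConn z b ∩ (openConn p b)ᶜ ∩ (openConn p' b)ᶜ ∩ (openConn j p ∪ openConn j p')) := by
  have key := spectatorExchange_portBelow w b z j p' p hp'z
  have hE1 : ((openConn p' b ∪ openConn p b) ∩ (openConn z b)ᶜ ∩ (openConn z p')ᶜ ∩ (openConn z p)ᶜ ∩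
      (openConn z j)ᶜ : Set (BondConfig V)) =
      (openConn p b ∪ openConn p' b) ∩ (openConn z b)ᶜ ∩ (openConn z p)ᶜ ∩ (openConn z p')ᶜ ∩ (openConn z j)ᶜ := by
    ext ω
    simp only [mem_inter_iff, mem_union, mem_compl_iff]
    tauto
  have hE2 : (openConn z b ∩ (openConn p' b)ᶜ ∩ (openConn p b)ᶜ ∩ (openConn j p' ∪ openConn j p) :
      Set (BondConfig V)) =
      openConn z b ∩ (openConn p b)ᶜ ∩ (openConn p' b)ᶜ ∩ (openConn j p ∪ openConn j p') := by
    ext ω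
    simp only [mem_inter_iff, mem_union, mem_compl_iff]
    tauto
  rw [hE1, hE2] at key
  exact key

/-- **The block below a port**: with `D` as in the module docstring, if `a_z ≤ a_p` then `0 ≤ D`, i.e.
`P(z↔b, p↮b, p′↮b, j↔A) ≤ P(A↔b, z ≁ b,p,p′,j)`.  Kozma–Nitzan Lemma 3(ii) for `(z, p)` with the decreasing event
`{z ↮ j, p, p′}` of the cluster of `z`. [cite: KozmaNitzan2024, Lemma 3(ii) (pp. 6–7), (9) (pp. 9–10)] -/
theorem spectatorExchange_blockBelow (w : Sym2 V → unitInterval) (b z j p p' : V)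
    (hzp : (prodBernoulli w).real (openConn z b) ≤ (prodBernoulli w).real (openConn p b)) :
    0 ≤ (prodBernoulli w).real ((openConn p b ∪ openConn p' b) ∩ (openConn z b)ᶜ ∩ (openConn z p)ᶜ ∩
          (openConn z p')ᶜ ∩ (openConn z j)ᶜ) -
        (prodBernoulli w).real (openConn z b ∩ (openConn p b)ᶜ ∩ (openConn p' b)ᶜ ∩ (openConn j p ∪ openConn j p')) := by
  set μ := prodBernoulli w with hμ
  set B : Set V := {j, p, p'} with hB
  -- Lemma 3(ii): `μ(zb, z ↮ B) ≤ μ(pb, z ↮ B)`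
  have L3 := KozmaNitzan2024_lemma3_ii_notConn w z p b B hzp
  have h1 : μ.real (openConn z b ∩ (openConn p b)ᶜ ∩ (openConn p' b)ᶜ ∩ (openConn j p ∪ openConn j p')) ≤
      μ.real (openConn z b ∩ {ω : BondConfig V | ∀ u ∈ B, ¬ (openGraph ω).Reachable z u}) := by
    apply measureReal_mono
    · rintro ω ⟨⟨⟨hzbω, hpbω⟩, hp'bω⟩, hjA⟩
      refine ⟨hzbω, ?_⟩
      have hzp : ¬ (openGraph ω).Reachable z p := fun h => hpbω (h.symm.trans hzbω)
      have hzp' : ¬ (openGraph ω).Reachable z p' := fun h => hp'bω (h.symm.trans hzbω)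
      have hzj : ¬ (openGraph ω).Reachable z j := by
        intro h
        rcases hjA with hjp | hjp'
        · exact hzp (h.trans hjp)
        · exact hzp' (h.trans hjp')
      intro u hu
      simp only [hB, mem_insert_iff, mem_singleton_iff] at hu
      rcases hu with rfl | rfl | rfl
      · exact hzj
      · exact hzp
      · exact hzp'
    · exact measure_ne_top _ _
  have h2 : μ.real (openConn p b ∩ {ω : BondConfig V | ∀ u ∈ B, ¬ (openGraph ω).Reachable z u}) ≤
      μ.real ((openConn p b ∪ openConn p' b) ∩ (openConn z b)ᶜ ∩ (openConn z p)ᶜ ∩ (openConn z p')ᶜ ∩ (openConn z j)ᶜ) := by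
    apply measureReal_mono
    · rintro ω ⟨hpbω, hBω⟩
      have hzj : ¬ (openGraph ω).Reachable z j := hBω j (by simp [hB])
      have hzp : ¬ (openGraph ω).Reachable z p := hBω p (by simp [hB])
      have hzp' : ¬ (openGraph ω).Reachable z p' := hBω p' (by simp [hB])
      refine ⟨⟨⟨⟨Or.inl hpbω, fun hzbω => hzp ?_⟩, hzp⟩, hzp'⟩, hzj⟩
      exact (hzbω : (openGraph ω).Reachable z b).trans (hpbω : (openGraph ω).Reachable p b).symm
    · exact measure_ne_top _ _
  linarith

/-- **The block below a port**, second port: if `a_z ≤ a_{p′}` then `0 ≤ D`.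
[cite: KozmaNitzan2024, Lemma 3(ii) (pp. 6–7), (9) (pp. 9–10)] -/
theorem spectatorExchange_blockBelow' (w : Sym2 V → unitInterval) (b z j p p' : V)
    (hzp' : (prodBernoulli w).real (openConn z b) ≤ (prodBernoulli w).real (openConn p' b)) :
    0 ≤ (prodBernoulli w).real ((openConn p b ∪ openConn p' b) ∩ (openConn z b)ᶜ ∩ (openConn z p)ᶜ ∩
          (openConn z p')ᶜ ∩ (openConn z j)ᶜ) -
        (prodBernoulli w).real (openConn z b ∩ (openConn p b)ᶜ ∩ (openConn p' b)ᶜ ∩ (openConn j p ∪ openConn j p')) := by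
  have key := spectatorExchange_blockBelow w b z j p' p hzp'
  have hE1 : ((openConn p' b ∪ openConn p b) ∩ (openConn z b)ᶜ ∩ (openConn z p')ᶜ ∩ (openConn z p)ᶜ ∩
      (openConn z j)ᶜ : Set (BondConfig V)) =
      (openConn p b ∪ openConn p' b) ∩ (openConn z b)ᶜ ∩ (openConn z p)ᶜ ∩ (openConn z p')ᶜ ∩ (openConn z j)ᶜ := by
    ext ω
    simp only [mem_inter_iff, mem_union, mem_compl_iff]
    tauto
  have hE2 : (openConn z b ∩ (openConn p' b)ᶜ ∩ (openConn p b)ᶜ ∩ (openConn j p' ∪ openConn j p) :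
      Set (BondConfig V)) =
      openConn z b ∩ (openConn p b)ᶜ ∩ (openConn p' b)ᶜ ∩ (openConn j p ∪ openConn j p') := by
    ext ω
    simp only [mem_inter_iff, mem_union, mem_compl_iff]
    tauto
  rw [hE1, hE2] at key
  exact key

/-- **Spectator exchange when at most one of `z, p, p′` is strictly below the spectator**: with `D` as in the module
docstring, if `a_j ≤ a_z ∨ a_j ≤ a_p`, `a_j ≤ a_z ∨ a_j ≤ a_{p′}` and `a_j ≤ a_p ∨ a_j ≤ a_{p′}` (equivalently: at most one
of `a_z, a_p, a_{p′}` is `< a_j`), then `a_j − a_z ≤ D`.  Cases: `spectatorExchange_weakest` (gen 13, robust Question 7),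
`spectatorExchange_portBelow`, `spectatorExchange_blockBelow`.
[cite: KozmaNitzan2024, Lemma 3 (pp. 6–7), (9) (pp. 9–10), Question 7 (p. 36)] -/
theorem spectatorExchange_atMostOneBelow (w : Sym2 V → unitInterval) (b z j p p' : V)
    (hzb : z ≠ b) (hpb : p ≠ b) (hp'b : p' ≠ b) (hjb : j ≠ b) (hpp' : p ≠ p') (hpj : p ≠ j) (hp'j : p' ≠ j)
    (h1 : (prodBernoulli w).real (openConn j b) ≤ (prodBernoulli w).real (openConn z b) ∨
      (prodBernoulli w).real (openConn j b) ≤ (prodBernoulli w).real (openConn p b))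
    (h2 : (prodBernoulli w).real (openConn j b) ≤ (prodBernoulli w).real (openConn z b) ∨
      (prodBernoulli w).real (openConn j b) ≤ (prodBernoulli w).real (openConn p' b))
    (h3 : (prodBernoulli w).real (openConn j b) ≤ (prodBernoulli w).real (openConn p b) ∨
      (prodBernoulli w).real (openConn j b) ≤ (prodBernoulli w).real (openConn p' b)) :
    (prodBernoulli w).real (openConn j b) - (prodBernoulli w).real (openConn z b) ≤
      (prodBernoulli w).real ((openConn p b ∪ openConn p' b) ∩ (openConn z b)ᶜ ∩ (openConn z p)ᶜ ∩
          (openConn z p')ᶜ ∩ (openConn z j)ᶜ) -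
        (prodBernoulli w).real (openConn z b ∩ (openConn p b)ᶜ ∩ (openConn p' b)ᶜ ∩ (openConn j p ∪ openConn j p')) := by
  set μ := prodBernoulli w with hμ
  set aj := μ.real (openConn j b) with haj
  set az := μ.real (openConn z b) with haz
  set ap := μ.real (openConn p b) with hap
  set aq := μ.real (openConn p' b) with haq
  by_cases hjp : aj ≤ ap
  · by_cases hjq : aj ≤ aq
    · -- the spectator is the weakest of `p, p', j`
      exact spectatorExchange_weakest w b z j p p' hzb hpb hp'b hjb hpp' hpj hp'j hjp hjq
    · -- `p' < j ≤ p`, hence `j ≤ z`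
      have hjz : aj ≤ az := h2.resolve_right hjq
      rcases le_total ap az with hpz | hzp
      · have key := spectatorExchange_portBelow w b z j p p' hpz
        linarith
      · have key := spectatorExchange_blockBelow w b z j p p' hzp
        linarith
  · -- `p < j`, hence `j ≤ p'` and `j ≤ z`
    have hjq : aj ≤ aq := h3.resolve_left hjp
    have hjz : aj ≤ az := h1.resolve_right hjp
    rcases le_total aq az with hqz | hzq
    · have key := spectatorExchange_portBelow' w b z j p p' hqz
      linarith
    · have key := spectatorExchange_blockBelow' w b z j p p' hzq
      linarith

end UpsetExchange

end

end Summit.CriticalPhenomena.PercolationContinuityZ3.Theorems
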